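import Mathlib
import Summits.QuantumFields.BalabanUV.Beta.UnitLatticeOmegaTorus

/-!
# `Summit.QuantumFields.BalabanUV.Beta.UnitLatticeOmegaFibred` — THE Ω-LAYER ENDs FOR FIBRED (VECTOR-VALUED) SITES: the
# numbers-only ENDs `UnitLatticeOmegaBoxEnd.termSum_box_end` ∕ `UnitLatticeOmegaBoxTilt.termSum_box_tilt` (box) and
# `UnitLatticeOmegaTorus.termSum_torus_end` ∕ `termSum_torus_tilt` (torus) with the INJECTIVITY of the site map replaced by
# a FIBRE BOUND `#{y : e y = x} ≤ m` — the index of a 𝔤-valued lattice 1-form is (site × direction × colour component), so the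
# site map of Bałaban's fields is `m`-to-one with `m = d·dim 𝔤`, never injective; the lattice profiles pick up exactly the
# factor `m` and nothing else changes

HONEST FRAMING (page 1 of everything in this cell).  Discharging `FlowStep.BetaPertH` would make Bałaban's ultraviolet
stability UNCONDITIONAL — a constructive-QFT result; NOT the continuum limit, NOT the Clay problem.  This module
discharges nothing of `BetaPertH`; [folklore] bookkeeping, kernel-checked (unit `b2b-balaban-beta-d4-p3`, road P3, gen 6).
WHY: the row-D4 chain is written over an abstract finite index `Y` with a pseudo-metric; its MODEL instances (co-owner
d4-p2's `CovariantTowerRowData.rowData_tower_torus` on `UT N × Cp`, the owner's `CoarseCoerciveCovariantEnergy` on `S × Cp`)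
and print's objects ([13] (3.19): `R(U(Γ))` acts on the colour fibre; [I] (4.4): 1-forms) are FIBRED over the lattice, and
this lineage's numbers-only ENDs (gen 5 box, gen 6 torus) asked for an INJECTIVE site map — adequate for scalar models only.
Here the same ENDs are stated for `m`-to-one site maps: the two profiles `L`, `L₁` become `m·L⋆`, `m·L₁⋆` (b05's
`B5Commutator128.rowsum_fibre_le` is the same remark for the (1.128) row sums), every other hypothesis VERBATIM.  Nothing of
Bałaban's operators is instantiated ((T3) = `hT`, E-I3 = `hRe`, NODE O.2 untouched); readiness width 0 unchanged; NOT
summit progress.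
HONEST DEPENDENCY: continuum YM on T⁴ ⇐ BetaPertH ∧ nine spine estimates (0/9 proved); BetaPertH ⇐
(D1) ∧ (D4) ∧ CAP+tail; G-an2-4 gates asym, D1 and NE2/3/4.

CITATION (locator only; nothing printed is used as a hypothesis).  [13] = T. Bałaban, *Propagators for lattice gauge
theories in a background field*, Commun. Math. Phys. **99**, 389–434 (1985) [Balaban1985BackgroundPropagators], (3.19)
p. 393 (the transports on the fibre), (3.42) p. 397 (norms of vector-valued kernels); [II] = T. Bałaban, Commun. Math. Phys.
**116**, 1–22 (1988) [Balaban1988RG2Cluster], p. 13 after (2.7), p. 16 (2.16)–(2.17).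

CONTENTS (0 sorry).  §1 `sum_comp_le_mul_sum_image` (a sum through an `m`-to-one map is at most `m` times the sum over the
image).  §2 fibred profiles on boxes of `ℤ^ν`: **`profile_zero_le_fibre`**, **`profile_one_le_fibre`** (the closed forms of
`UnitLatticeProfiles` times `m`).  §3 fibred profiles on the torus: **`tprofile_zero_le_fibre`**, **`tprofile_one_le_fibre`**.
§4 the ENDs for fibred sites: **`termSum_box_end_fibre`**, **`termSum_box_tilt_fibre`**, **`termSum_torus_end_fibre`**,
**`termSum_torus_tilt_fibre`** (`termSum_box_of_pieceMaj` ∕ `termSum_torus_of_pieceMaj` with the fibred profiles plugged in).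
§5 non-vacuity: two sites over ONE point of `ℤ∕8` (`m = 2`).
NOT HERE: any instance on Bałaban's operators.  NOT summit progress.
-/

open scoped BigOperators Matrix
open Finset Matrix Metric Real

namespace Summit.QuantumFields.BalabanUV.Beta.UnitLatticeOmegaFibred

open Summit.QuantumFields.BalabanUV.Beta.UnitLatticeWalkInversion
open Summit.QuantumFields.BalabanUV.Beta.UnitLatticeWalkInversionDecay (locInv)
open Summit.QuantumFields.BalabanUV.Beta.UnitLatticeTubeCount (supDist supDistOn)
open Summit.QuantumFields.BalabanUV.Beta.UnitLatticePartition (hPart EPart)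
open Summit.QuantumFields.BalabanUV.Beta.UnitLatticeProfiles (sum_prod_pow_natAbs_le exp_supDist_le_prod
  supDistOn_eq_supDist_sub)
open Summit.QuantumFields.BalabanUV.Beta.UnitLatticeTorusPartition
open Summit.QuantumFields.BalabanUV.Beta.UnitLatticeOmegaTerms
open Summit.QuantumFields.BalabanUV.Beta.UnitLatticeOmegaRowData
open Summit.QuantumFields.BalabanUV.Beta.UnitLatticeOmegaBudgets (le_exp_mul_div)
open Summit.QuantumFields.BalabanUV.Beta.UnitLatticeOmegaBox
open Summit.QuantumFields.BalabanUV.Beta.UnitLatticeOmegaBoxLocal (termSum_box_of_pieceMaj)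
open Summit.QuantumFields.BalabanUV.Beta.UnitLatticeOmegaBoxTilt (rowBound_pieceK colBound_pieceK cells_pieceK
  reCoercive_one_add_tilt)
open Summit.QuantumFields.BalabanUV.Beta.UnitLatticeOmegaTorus
open Summit.QuantumFields.BalabanUV.Beta.AnalyticWalkSum216 (termSum)
open Summit.QuantumFields.BalabanUV.Beta.AnalyticWalkSum216RowResolvent (pieceMaj pieceK Ktot_pieceK)
open Literature.MathematicalPhysics.QuantumFieldTheory.Balaban1983to89
open B4Sect5Torus (TSite tdist torusSum_le)
open B5TorusCover (UT Ctr ctrU)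
open B5Prop11Lower (nsq)

noncomputable section

variable {Y : Type*} [Fintype Y] [DecidableEq Y] {Ω : Type*} [Fintype Ω] [DecidableEq Ω]

/-! ## §1 Sums through an `m`-to-one map -/

omit [DecidableEq Y] [Fintype Ω] [DecidableEq Ω] in
/-- **A sum through an `m`-to-one map is at most `m` times the sum over its image** (nonnegative summands). [folklore] -/
theorem sum_comp_le_mul_sum_image {X : Type*} [DecidableEq X] (e : Y → X) {m : ℕ}
    (hm : ∀ x, ((Finset.univ.filter fun y => e y = x).card : ℝ) ≤ m) (f : X → ℝ) (hf : ∀ x, 0 ≤ f x) :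
    ∑ y, f (e y) ≤ m * ∑ x ∈ Finset.univ.image e, f x := by
  rw [Finset.sum_comp, Finset.mul_sum]
  refine Finset.sum_le_sum fun x _ => ?_
  rw [nsmul_eq_mul]
  exact mul_le_mul_of_nonneg_right (hm x) (hf x)

/-! ## §2 Fibred profiles on boxes of `ℤ^ν` -/

section Box

variable {ν : ℕ}

omit [DecidableEq Y] [Fintype Ω] [DecidableEq Ω] in
/-- **ZEROTH PROFILE, FIBRED**: for an `m`-to-one site map `e : Y → ℤ^ν` and `a > 0`,
`Σ_j e^{−a·supDistOn e i j} ≤ m·(2(1 − e^{−a∕ν})⁻¹)^ν`. [folklore] -/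
theorem profile_zero_le_fibre (hν : 0 < ν) (e : Y → (Fin ν → ℤ)) {m : ℕ}
    (hm : ∀ x, ((Finset.univ.filter fun y => e y = x).card : ℝ) ≤ m) {a : ℝ} (ha : 0 < a) (i : Y) :
    ∑ j, Real.exp (-(a * supDistOn e i j)) ≤ m * (2 * (1 - Real.exp (-(a / ν)))⁻¹) ^ ν := by
  classical
  set q := Real.exp (-(a / ν)) with hq
  have hq0 : 0 ≤ q := (Real.exp_pos _).le
  have hq1 : q < 1 := Real.exp_lt_one_iff.2 (by
    have hν' : (0 : ℝ) < ν := by exact_mod_cast hν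
    exact neg_neg_of_pos (div_pos ha hν'))
  have hstep : ∀ j, Real.exp (-(a * supDistOn e i j)) ≤ ∏ k, q ^ ((e j - e i) k).natAbs := fun j => by
    rw [supDistOn_eq_supDist_sub]
    exact exp_supDist_le_prod hν ha.le (e j - e i)
  have hfib : ∑ j, ∏ k, q ^ ((e j - e i) k).natAbs
      ≤ m * ∑ x ∈ Finset.univ.image e, ∏ k, q ^ ((x - e i) k).natAbs :=
    sum_comp_le_mul_sum_image e hm (fun x => ∏ k, q ^ ((x - e i) k).natAbs)
      fun x => Finset.prod_nonneg fun k _ => pow_nonneg hq0 _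
  have himg : ∑ x ∈ Finset.univ.image e, ∏ k, q ^ ((x - e i) k).natAbs
      = ∑ z ∈ (Finset.univ.image e).image (fun x => x - e i), ∏ k, q ^ (z k).natAbs := by
    rw [Finset.sum_image fun x _ y _ h => sub_left_injective h]
  calc ∑ j, Real.exp (-(a * supDistOn e i j)) ≤ ∑ j, ∏ k, q ^ ((e j - e i) k).natAbs :=
        Finset.sum_le_sum fun j _ => hstep j
    _ ≤ m * ∑ x ∈ Finset.univ.image e, ∏ k, q ^ ((x - e i) k).natAbs := hfib
    _ ≤ m * (2 * (1 - q)⁻¹) ^ ν := by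
        rw [himg]
        exact mul_le_mul_of_nonneg_left (sum_prod_pow_natAbs_le hq0 hq1 _) (Nat.cast_nonneg m)

omit [DecidableEq Y] [Fintype Ω] [DecidableEq Ω] in
/-- **FIRST PROFILE, FIBRED**: for an `m`-to-one `e` and `0 < b < a`,
`Σ_j supDistOn e i j·e^{−a·supDistOn e i j} ≤ (e·b)⁻¹·(m·(2(1 − e^{−(a−b)∕ν})⁻¹)^ν)`. [folklore] -/
theorem profile_one_le_fibre (hν : 0 < ν) (e : Y → (Fin ν → ℤ)) {m : ℕ}
    (hm : ∀ x, ((Finset.univ.filter fun y => e y = x).card : ℝ) ≤ m) {a b : ℝ} (hb : 0 < b) (hab : b < a) (i : Y) :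
    ∑ j, supDistOn e i j * Real.exp (-(a * supDistOn e i j))
      ≤ (Real.exp 1 * b)⁻¹ * (m * (2 * (1 - Real.exp (-((a - b) / ν)))⁻¹) ^ ν) := by
  have hterm : ∀ j, supDistOn e i j * Real.exp (-(a * supDistOn e i j))
      ≤ (Real.exp 1 * b)⁻¹ * Real.exp (-((a - b) * supDistOn e i j)) := by
    intro j
    have h1 : supDistOn e i j ≤ Real.exp (b * supDistOn e i j) / (Real.exp 1 * b) := le_exp_mul_div hb
    calc supDistOn e i j * Real.exp (-(a * supDistOn e i j))
        ≤ Real.exp (b * supDistOn e i j) / (Real.exp 1 * b) * Real.exp (-(a * supDistOn e i j)) :=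
          mul_le_mul_of_nonneg_right h1 (Real.exp_pos _).le
      _ = (Real.exp 1 * b)⁻¹ * (Real.exp (b * supDistOn e i j) * Real.exp (-(a * supDistOn e i j))) := by
          rw [div_eq_mul_inv]; ring
      _ = (Real.exp 1 * b)⁻¹ * Real.exp (-((a - b) * supDistOn e i j)) := by
          rw [← Real.exp_add]; ring_nf
  calc ∑ j, supDistOn e i j * Real.exp (-(a * supDistOn e i j))
      ≤ ∑ j, (Real.exp 1 * b)⁻¹ * Real.exp (-((a - b) * supDistOn e i j)) := Finset.sum_le_sum fun j _ => hterm j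
    _ = (Real.exp 1 * b)⁻¹ * ∑ j, Real.exp (-((a - b) * supDistOn e i j)) := by rw [Finset.mul_sum]
    _ ≤ (Real.exp 1 * b)⁻¹ * (m * (2 * (1 - Real.exp (-((a - b) / ν)))⁻¹) ^ ν) :=
        mul_le_mul_of_nonneg_left (profile_zero_le_fibre hν e hm (sub_pos.2 hab) i) (by positivity)

end Box

/-! ## §3 Fibred profiles on the torus -/

section Torus

variable {ν : ℕ} {N : Fin ν → ℕ} [∀ i, NeZero (N i)]

omit [DecidableEq Y] [Fintype Ω] [DecidableEq Ω] in
/-- **ZEROTH PROFILE ON THE TORUS, FIBRED**: for an `m`-to-one `e : Y → UT N` and `a > 0`,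
`Σ_j e^{−a·tdistOn e i j} ≤ m·(2(1 − e^{−a∕ν})⁻¹)^ν` (b04 `torusSum_le`; cf. b05 `B5Commutator128.rowsum_fibre_le`).
[folklore] -/
theorem tprofile_zero_le_fibre (e : Y → UT N) {m : ℕ}
    (hm : ∀ x, ((Finset.univ.filter fun y => e y = x).card : ℝ) ≤ m) {a : ℝ} (ha : 0 < a) (i : Y) :
    ∑ j, Real.exp (-(a * tdistOn e i j)) ≤ m * (2 * (1 - Real.exp (-(a / ν)))⁻¹) ^ ν := by
  classical
  have hfib : ∑ j, Real.exp (-(a * dist (e i) (e j))) ≤ m * ∑ x ∈ Finset.univ.image e, Real.exp (-(a * dist (e i) x)) :=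
    sum_comp_le_mul_sum_image e hm (fun x => Real.exp (-(a * dist (e i) x))) fun x => (Real.exp_pos _).le
  calc ∑ j, Real.exp (-(a * tdistOn e i j)) = ∑ j, Real.exp (-(a * dist (e i) (e j))) := rfl
    _ ≤ m * ∑ x ∈ Finset.univ.image e, Real.exp (-(a * dist (e i) x)) := hfib
    _ ≤ m * ∑ x : UT N, Real.exp (-(a * dist (e i) x)) := mul_le_mul_of_nonneg_left
        (Finset.sum_le_univ_sum_of_nonneg fun _ => (Real.exp_pos _).le) (Nat.cast_nonneg m)
    _ = m * ∑ x : TSite ν N, Real.exp (-(a * tdist N (UT.toSite N (e i)) x)) := rfl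
    _ ≤ m * B4Sect5Proof.latticeConst ν a :=
        mul_le_mul_of_nonneg_left (torusSum_le ν (UT.one_le N) ha _) (Nat.cast_nonneg m)
    _ = m * (2 * (1 - Real.exp (-(a / ν)))⁻¹) ^ ν := rfl

omit [DecidableEq Y] [Fintype Ω] [DecidableEq Ω] in
/-- **FIRST PROFILE ON THE TORUS, FIBRED**: for an `m`-to-one `e` and `0 < b < a`,
`Σ_j tdistOn e i j·e^{−a·tdistOn e i j} ≤ (e·b)⁻¹·(m·(2(1 − e^{−(a−b)∕ν})⁻¹)^ν)`. [folklore] -/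
theorem tprofile_one_le_fibre (e : Y → UT N) {m : ℕ}
    (hm : ∀ x, ((Finset.univ.filter fun y => e y = x).card : ℝ) ≤ m) {a b : ℝ} (hb : 0 < b) (hab : b < a) (i : Y) :
    ∑ j, tdistOn e i j * Real.exp (-(a * tdistOn e i j))
      ≤ (Real.exp 1 * b)⁻¹ * (m * (2 * (1 - Real.exp (-((a - b) / ν)))⁻¹) ^ ν) := by
  have hterm : ∀ j, tdistOn e i j * Real.exp (-(a * tdistOn e i j))
      ≤ (Real.exp 1 * b)⁻¹ * Real.exp (-((a - b) * tdistOn e i j)) := by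
    intro j
    have h1 : tdistOn e i j ≤ Real.exp (b * tdistOn e i j) / (Real.exp 1 * b) := le_exp_mul_div hb
    calc tdistOn e i j * Real.exp (-(a * tdistOn e i j))
        ≤ Real.exp (b * tdistOn e i j) / (Real.exp 1 * b) * Real.exp (-(a * tdistOn e i j)) :=
          mul_le_mul_of_nonneg_right h1 (Real.exp_pos _).le
      _ = (Real.exp 1 * b)⁻¹ * (Real.exp (b * tdistOn e i j) * Real.exp (-(a * tdistOn e i j))) := by
          rw [div_eq_mul_inv]; ring
      _ = (Real.exp 1 * b)⁻¹ * Real.exp (-((a - b) * tdistOn e i j)) := by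
          rw [← Real.exp_add]; ring_nf
  calc ∑ j, tdistOn e i j * Real.exp (-(a * tdistOn e i j))
      ≤ ∑ j, (Real.exp 1 * b)⁻¹ * Real.exp (-((a - b) * tdistOn e i j)) := Finset.sum_le_sum fun j _ => hterm j
    _ = (Real.exp 1 * b)⁻¹ * ∑ j, Real.exp (-((a - b) * tdistOn e i j)) := by rw [Finset.mul_sum]
    _ ≤ (Real.exp 1 * b)⁻¹ * (m * (2 * (1 - Real.exp (-((a - b) / ν)))⁻¹) ^ ν) :=
        mul_le_mul_of_nonneg_left (tprofile_zero_le_fibre e hm (sub_pos.2 hab) i) (by positivity)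

end Torus

/-! ## §4 The ENDs for fibred sites -/

section BoxEnds

variable {ν q : ℕ}

/-- **THE END ON A BOX, NUMBERS ONLY, FIBRED SITES.**  `UnitLatticeOmegaBoxEnd.termSum_box_end` with `he : Injective e`
replaced by the fibre bound `#{y : e y = x} ≤ m`; the profiles `L := m·L⋆(κ_c − κ′)`, `L₁ := m·L₁⋆(κ⁺ − κ_c)`; everything
else verbatim. [cite: Balaban1988RG2Cluster, p.13 after (2.7)] -/
theorem termSum_box_end_fibre (hν : 0 < ν) {M Md : ℕ} (hM : 0 < M) (hMd : 8 * M ≤ Md) (e : Y → (Fin ν → ℤ)) {m : ℕ}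
    (hm : ∀ x, ((Finset.univ.filter fun y => e y = x).card : ℝ) ≤ m) (hbox : ∀ y i, 0 ≤ e y i ∧ e y i ≤ q * M)
    {κ κ₁ κ₂ κp ρ ρc m₀ γ κc : ℝ} (hκ : 0 ≤ κ) (hκ₁ : 0 < κ₁) (hκ₂ : 0 ≤ κ₂)
    (K : Ω → Matrix Y Y ℂ) (cellsOf : Ω → Finset (Fin ν → ℤ))
    (hKcells : ∀ ω k l, K ω k l ≠ 0 → cellAt Md e k ∈ cellsOf ω)
    (near : (Fin ν → Fin (q + 1)) → Finset Ω) (hnear : ∀ b ω, ω ∉ near b → m₀ ≤ (cellsOf ω).card)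
    (hκc : κ + κ₁ * ((2 ^ ν : ℕ) / (2 * (M : ℝ))) < κc) (hκcp : κc < κp)
    (hT : ∀ k, ∑ l, (∑ ω, pieceMaj (κ₁ + κ₂) K cellsOf ω k l) * Real.exp (κp * supDistOn e k l) ≤ ρ)
    (hTc : ∀ l, ∑ k, (∑ ω, pieceMaj (κ₁ + κ₂) K cellsOf ω k l) * Real.exp (κp * supDistOn e k l) ≤ ρc)
    (hRe : ∀ z : Y → ℂ, γ * nsq z ≤ (star z ⬝ᵥ ((1 + Ktot K) *ᵥ z)).re)
    (hmn : κc * ρ * ((Real.exp 1 * ((κp - κc) / 2))⁻¹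
          * (m * (2 * (1 - Real.exp (-((κp - κc - (κp - κc) / 2) / ν)))⁻¹) ^ ν))
        < γ - Real.exp (-((κ₁ + κ₂) * m₀)) * (ρ + ρc) / 2)
    (hρ : (γ - Real.exp (-((κ₁ + κ₂) * m₀)) * (ρ + ρc) / 2
          - κc * ρ * ((Real.exp 1 * ((κp - κc) / 2))⁻¹
            * (m * (2 * (1 - Real.exp (-((κp - κc - (κp - κc) / 2) / ν)))⁻¹) ^ ν)))⁻¹
        * (m * (2 * (1 - Real.exp (-((κc - (κ + κ₁ * ((2 ^ ν : ℕ) / (2 * (M : ℝ))))) / ν)))⁻¹) ^ ν)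
        * (2 * (2 : ℝ) ^ ν / (2 * (M : ℝ) / (ν * π))
          * ((Real.exp 1 * (κp - (κ + κ₁ * ((2 ^ ν : ℕ) / (2 * (M : ℝ))))))⁻¹ * ρ)
          + (2 : ℝ) ^ ν * Real.exp (-(κ₂ * m₀)) * ρ) < 1) (Δ₀ : Fin ν → ℤ) :
    termSum (decFamilyΩ (cellAt Md e) (EPart M q e) (domOf Md e cellsOf) (hPart M q e) K near
      (fun b => locInv (Knear K near b) (EPart M q e) b) (fun _ => (1 : ℂ)) Δ₀) 1 = (1 + Ktot K)⁻¹ := by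
  have hb : 0 < (κp - κc) / 2 := by linarith
  have hab : (κp - κc) / 2 < κp - κc := by linarith
  have hL0 : (0 : ℝ) ≤ m * (2 * (1 - Real.exp (-((κc - (κ + κ₁ * ((2 ^ ν : ℕ) / (2 * (M : ℝ))))) / ν)))⁻¹) ^ ν := by
    refine mul_nonneg (Nat.cast_nonneg m) (pow_nonneg (mul_nonneg zero_le_two (inv_nonneg.2 (sub_nonneg.2 ?_))) ν)
    exact Real.exp_le_one_iff.2 (neg_nonpos.2 (div_nonneg (by linarith) (Nat.cast_nonneg ν)))
  have hκ'0 : 0 ≤ κ + κ₁ * ((2 ^ ν : ℕ) / (2 * (M : ℝ))) := by positivity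
  exact termSum_box_of_pieceMaj hν hM hMd e hbox hκ hκ₁ hκ₂ K cellsOf hKcells near hnear (hκc.trans hκcp) hT hTc hRe
    (hκ'0.trans hκc.le) (fun i => profile_one_le_fibre hν e hm hb hab i)
    (fun i => profile_zero_le_fibre hν e hm (sub_pos.2 hκc) i) hL0 hmn hρ Δ₀

/-- **THE x-TILT LAYER ON A BOX, FIBRED SITES** — `UnitLatticeOmegaBoxTilt.termSum_box_tilt` with the fibre bound in place
of injectivity. [cite: Balaban1988RG2Cluster, p.13 after (2.7)] -/
theorem termSum_box_tilt_fibre (hν : 0 < ν) {M Md : ℕ} (hM : 0 < M) (hMd : 8 * M ≤ Md) (e : Y → (Fin ν → ℤ)) {m : ℕ}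
    (hm : ∀ x, ((Finset.univ.filter fun y => e y = x).card : ℝ) ≤ m) (hbox : ∀ y i, 0 ≤ e y i ∧ e y i ≤ q * M)
    {κ κ₁ κ₂ κp ρ₀ ρc₀ m₀ κc X : ℝ} (hκ : 0 ≤ κ) (hκ₁ : 0 < κ₁) (hκ₂ : 0 ≤ κ₂)
    (Rm : Matrix Y Y ℂ) (hR : ∀ i j, (starRingEnd ℂ) (Rm i j) = Rm i j) (G : Ω → Matrix Y Y ℂ)
    (hpsd : ∀ g : Y → ℂ, 0 ≤ (star g ⬝ᵥ (Ktot G *ᵥ g)).re) (cellsOf : Ω → Finset (Fin ν → ℤ))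
    (hKcells₀ : ∀ ω k l, (Rm * G ω * Rmᵀ) k l ≠ 0 → cellAt Md e k ∈ cellsOf ω)
    (near : (Fin ν → Fin (q + 1)) → Finset Ω) (hnear : ∀ b ω, ω ∉ near b → m₀ ≤ (cellsOf ω).card)
    (hκc : κ + κ₁ * ((2 ^ ν : ℕ) / (2 * (M : ℝ))) < κc) (hκcp : κc < κp)
    (hT₀ : ∀ k, ∑ l, (∑ ω, pieceMaj (κ₁ + κ₂) (fun ω => Rm * G ω * Rmᵀ) cellsOf ω k l)
      * Real.exp (κp * supDistOn e k l) ≤ ρ₀)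
    (hTc₀ : ∀ l, ∑ k, (∑ ω, pieceMaj (κ₁ + κ₂) (fun ω => Rm * G ω * Rmᵀ) cellsOf ω k l)
      * Real.exp (κp * supDistOn e k l) ≤ ρc₀)
    (hmn : κc * (X * ρ₀) * ((Real.exp 1 * ((κp - κc) / 2))⁻¹
          * (m * (2 * (1 - Real.exp (-((κp - κc - (κp - κc) / 2) / ν)))⁻¹) ^ ν))
        < 1 - Real.exp (-((κ₁ + κ₂) * m₀)) * (X * ρ₀ + X * ρc₀) / 2)
    (hρ : (1 - Real.exp (-((κ₁ + κ₂) * m₀)) * (X * ρ₀ + X * ρc₀) / 2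
          - κc * (X * ρ₀) * ((Real.exp 1 * ((κp - κc) / 2))⁻¹
            * (m * (2 * (1 - Real.exp (-((κp - κc - (κp - κc) / 2) / ν)))⁻¹) ^ ν)))⁻¹
        * (m * (2 * (1 - Real.exp (-((κc - (κ + κ₁ * ((2 ^ ν : ℕ) / (2 * (M : ℝ))))) / ν)))⁻¹) ^ ν)
        * (2 * (2 : ℝ) ^ ν / (2 * (M : ℝ) / (ν * π))
          * ((Real.exp 1 * (κp - (κ + κ₁ * ((2 ^ ν : ℕ) / (2 * (M : ℝ))))))⁻¹ * (X * ρ₀))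
          + (2 : ℝ) ^ ν * Real.exp (-(κ₂ * m₀)) * (X * ρ₀)) < 1)
    {x : ℝ} (hx0 : 0 ≤ x) (hxX : x ≤ X) (Δ₀ : Fin ν → ℤ) :
    termSum (decFamilyΩ (cellAt Md e) (EPart M q e) (domOf Md e cellsOf) (hPart M q e) (pieceK Rm Rmᵀ G (x : ℂ)) near
      (fun b => locInv (Knear (pieceK Rm Rmᵀ G (x : ℂ)) near b) (EPart M q e) b) (fun _ => (1 : ℂ)) Δ₀) 1
      = (1 + (x : ℂ) • (Rm * Ktot G * Rmᵀ))⁻¹ := by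
  have hx : ‖(x : ℂ)‖ ≤ X := by rw [Complex.norm_real, Real.norm_of_nonneg hx0]; exact hxX
  rw [← Ktot_pieceK]
  exact termSum_box_end_fibre hν hM hMd e hm hbox hκ hκ₁ hκ₂ (pieceK Rm Rmᵀ G (x : ℂ)) cellsOf
    (cells_pieceK Md e Rm G cellsOf hKcells₀ (x : ℂ)) near hnear hκc hκcp
    (rowBound_pieceK Rm G cellsOf hx hT₀) (colBound_pieceK Rm G cellsOf hx hTc₀)
    (reCoercive_one_add_tilt Rm hR G hpsd hx0) hmn hρ Δ₀

end BoxEnds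

section TorusEnds

variable {ν : ℕ} {N : Fin ν → ℕ} [∀ i, NeZero (N i)] {M₀ Md : ℕ}

/-- **THE END ON THE TORUS, NUMBERS ONLY, FIBRED SITES.**  `UnitLatticeOmegaTorus.termSum_torus_end` with `he : Injective e`
replaced by the fibre bound `#{y : e y = x} ≤ m`; the profiles `L := m·L⋆(κ_c − κ′)`, `L₁ := m·L₁⋆(κ⁺ − κ_c)`; everything
else verbatim. [cite: Balaban1988RG2Cluster, p.13 after (2.7)] -/
theorem termSum_torus_end_fibre (hν : 0 < ν) (hM₀ : 1 ≤ M₀) (hdiv : ∀ i, M₀ ∣ N i) (h2N : ∀ i, 2 * M₀ ≤ N i)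
    (hMd : 8 * M₀ ≤ Md) (hdivd : ∀ i, Md ∣ N i) (e : Y → UT N) {m : ℕ}
    (hm : ∀ x, ((Finset.univ.filter fun y => e y = x).card : ℝ) ≤ m)
    {κ κ₁ κ₂ κp ρ ρc m₀ γ κc : ℝ} (hκ : 0 ≤ κ) (hκ₁ : 0 < κ₁) (hκ₂ : 0 ≤ κ₂)
    (K : Ω → Matrix Y Y ℂ) (cellsOf : Ω → Finset (Fin ν → ℤ))
    (hKcells : ∀ ω k l, K ω k l ≠ 0 → tcellAt Md e k ∈ cellsOf ω)
    (near : Ctr N M₀ → Finset Ω) (hnear : ∀ b ω, ω ∉ near b → m₀ ≤ (cellsOf ω).card)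
    (hκc : κ + κ₁ * ((2 ^ ν : ℕ) / (2 * (M₀ : ℝ))) < κc) (hκcp : κc < κp)
    (hT : ∀ k, ∑ l, (∑ ω, pieceMaj (κ₁ + κ₂) K cellsOf ω k l) * Real.exp (κp * tdistOn e k l) ≤ ρ)
    (hTc : ∀ l, ∑ k, (∑ ω, pieceMaj (κ₁ + κ₂) K cellsOf ω k l) * Real.exp (κp * tdistOn e k l) ≤ ρc)
    (hRe : ∀ z : Y → ℂ, γ * nsq z ≤ (star z ⬝ᵥ ((1 + Ktot K) *ᵥ z)).re)
    (hmn : κc * ρ * ((Real.exp 1 * ((κp - κc) / 2))⁻¹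
          * (m * (2 * (1 - Real.exp (-((κp - κc - (κp - κc) / 2) / ν)))⁻¹) ^ ν))
        < γ - Real.exp (-((κ₁ + κ₂) * m₀)) * (ρ + ρc) / 2)
    (hρ : (γ - Real.exp (-((κ₁ + κ₂) * m₀)) * (ρ + ρc) / 2
          - κc * ρ * ((Real.exp 1 * ((κp - κc) / 2))⁻¹
            * (m * (2 * (1 - Real.exp (-((κp - κc - (κp - κc) / 2) / ν)))⁻¹) ^ ν)))⁻¹
        * (m * (2 * (1 - Real.exp (-((κc - (κ + κ₁ * ((2 ^ ν : ℕ) / (2 * (M₀ : ℝ))))) / ν)))⁻¹) ^ ν)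
        * (2 * (2 : ℝ) ^ ν / ((M₀ : ℝ) / (4 * ν))
          * ((Real.exp 1 * (κp - (κ + κ₁ * ((2 ^ ν : ℕ) / (2 * (M₀ : ℝ))))))⁻¹ * ρ)
          + (2 : ℝ) ^ ν * Real.exp (-(κ₂ * m₀)) * ρ) < 1) (Δ₀ : Fin ν → ℤ) :
    termSum (decFamilyΩ (tcellAt Md e) (ETor M₀ e) (tdomOf Md e cellsOf) (hTor M₀ e) K near
      (fun b => locInv (Knear K near b) (ETor M₀ e) b) (fun _ => (1 : ℂ)) Δ₀) 1 = (1 + Ktot K)⁻¹ := by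
  have hb : 0 < (κp - κc) / 2 := by linarith
  have hab : (κp - κc) / 2 < κp - κc := by linarith
  have hL0 : (0 : ℝ) ≤ m * (2 * (1 - Real.exp (-((κc - (κ + κ₁ * ((2 ^ ν : ℕ) / (2 * (M₀ : ℝ))))) / ν)))⁻¹) ^ ν := by
    refine mul_nonneg (Nat.cast_nonneg m) (pow_nonneg (mul_nonneg zero_le_two (inv_nonneg.2 (sub_nonneg.2 ?_))) ν)
    exact Real.exp_le_one_iff.2 (neg_nonpos.2 (div_nonneg (by linarith) (Nat.cast_nonneg ν)))
  have hκ'0 : 0 ≤ κ + κ₁ * ((2 ^ ν : ℕ) / (2 * (M₀ : ℝ))) := by positivity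
  exact termSum_torus_of_pieceMaj hν hM₀ hdiv h2N hMd hdivd e hκ hκ₁ hκ₂ K cellsOf hKcells near hnear (hκc.trans hκcp)
    hT hTc hRe (hκ'0.trans hκc.le) (fun i => tprofile_one_le_fibre e hm hb hab i)
    (fun i => tprofile_zero_le_fibre e hm (sub_pos.2 hκc) i) hL0 hmn hρ Δ₀

/-- **THE x-TILT LAYER ON THE TORUS, FIBRED SITES** — `UnitLatticeOmegaTorus.termSum_torus_tilt` with the fibre bound in
place of injectivity. [cite: Balaban1988RG2Cluster, p.13 after (2.7)] -/
theorem termSum_torus_tilt_fibre (hν : 0 < ν) (hM₀ : 1 ≤ M₀) (hdiv : ∀ i, M₀ ∣ N i) (h2N : ∀ i, 2 * M₀ ≤ N i)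
    (hMd : 8 * M₀ ≤ Md) (hdivd : ∀ i, Md ∣ N i) (e : Y → UT N) {m : ℕ}
    (hm : ∀ x, ((Finset.univ.filter fun y => e y = x).card : ℝ) ≤ m)
    {κ κ₁ κ₂ κp ρ₀ ρc₀ m₀ κc X : ℝ} (hκ : 0 ≤ κ) (hκ₁ : 0 < κ₁) (hκ₂ : 0 ≤ κ₂)
    (Rm : Matrix Y Y ℂ) (hR : ∀ i j, (starRingEnd ℂ) (Rm i j) = Rm i j) (G : Ω → Matrix Y Y ℂ)
    (hpsd : ∀ g : Y → ℂ, 0 ≤ (star g ⬝ᵥ (Ktot G *ᵥ g)).re) (cellsOf : Ω → Finset (Fin ν → ℤ))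
    (hKcells₀ : ∀ ω k l, (Rm * G ω * Rmᵀ) k l ≠ 0 → tcellAt Md e k ∈ cellsOf ω)
    (near : Ctr N M₀ → Finset Ω) (hnear : ∀ b ω, ω ∉ near b → m₀ ≤ (cellsOf ω).card)
    (hκc : κ + κ₁ * ((2 ^ ν : ℕ) / (2 * (M₀ : ℝ))) < κc) (hκcp : κc < κp)
    (hT₀ : ∀ k, ∑ l, (∑ ω, pieceMaj (κ₁ + κ₂) (fun ω => Rm * G ω * Rmᵀ) cellsOf ω k l)
      * Real.exp (κp * tdistOn e k l) ≤ ρ₀)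
    (hTc₀ : ∀ l, ∑ k, (∑ ω, pieceMaj (κ₁ + κ₂) (fun ω => Rm * G ω * Rmᵀ) cellsOf ω k l)
      * Real.exp (κp * tdistOn e k l) ≤ ρc₀)
    (hmn : κc * (X * ρ₀) * ((Real.exp 1 * ((κp - κc) / 2))⁻¹
          * (m * (2 * (1 - Real.exp (-((κp - κc - (κp - κc) / 2) / ν)))⁻¹) ^ ν))
        < 1 - Real.exp (-((κ₁ + κ₂) * m₀)) * (X * ρ₀ + X * ρc₀) / 2)
    (hρ : (1 - Real.exp (-((κ₁ + κ₂) * m₀)) * (X * ρ₀ + X * ρc₀) / 2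
          - κc * (X * ρ₀) * ((Real.exp 1 * ((κp - κc) / 2))⁻¹
            * (m * (2 * (1 - Real.exp (-((κp - κc - (κp - κc) / 2) / ν)))⁻¹) ^ ν)))⁻¹
        * (m * (2 * (1 - Real.exp (-((κc - (κ + κ₁ * ((2 ^ ν : ℕ) / (2 * (M₀ : ℝ))))) / ν)))⁻¹) ^ ν)
        * (2 * (2 : ℝ) ^ ν / ((M₀ : ℝ) / (4 * ν))
          * ((Real.exp 1 * (κp - (κ + κ₁ * ((2 ^ ν : ℕ) / (2 * (M₀ : ℝ))))))⁻¹ * (X * ρ₀))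
          + (2 : ℝ) ^ ν * Real.exp (-(κ₂ * m₀)) * (X * ρ₀)) < 1)
    {x : ℝ} (hx0 : 0 ≤ x) (hxX : x ≤ X) (Δ₀ : Fin ν → ℤ) :
    termSum (decFamilyΩ (tcellAt Md e) (ETor M₀ e) (tdomOf Md e cellsOf) (hTor M₀ e) (pieceK Rm Rmᵀ G (x : ℂ)) near
      (fun b => locInv (Knear (pieceK Rm Rmᵀ G (x : ℂ)) near b) (ETor M₀ e) b) (fun _ => (1 : ℂ)) Δ₀) 1
      = (1 + (x : ℂ) • (Rm * Ktot G * Rmᵀ))⁻¹ := by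
  have hx : ‖(x : ℂ)‖ ≤ X := by rw [Complex.norm_real, Real.norm_of_nonneg hx0]; exact hxX
  rw [← Ktot_pieceK]
  exact termSum_torus_end_fibre hν hM₀ hdiv h2N hMd hdivd e hm hκ hκ₁ hκ₂ (pieceK Rm Rmᵀ G (x : ℂ)) cellsOf
    (tcells_pieceK Md e Rm G cellsOf hKcells₀ (x : ℂ)) near hnear hκc hκcp
    (rowBound_pieceK Rm G cellsOf hx hT₀) (colBound_pieceK Rm G cellsOf hx hTc₀)
    (reCoercive_one_add_tilt Rm hR G hpsd hx0) hmn hρ Δ₀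

end TorusEnds

/-! ## §5 Non-vacuity -/

/-- **NON-VACUITY, FIBRED**: TWO sites over ONE point of the circle `ℤ∕8` (`e ≡ 0`, fibre bound `m = 2` — not injective),
`ν = 1`, `N ≡ 8`, `M₀ = 1`, `M_d = 8`, zero pieces with empty cell budgets, `near ≡ univ`, `κ = 0`, `κ₁ = 1`, `κ₂ = 0`, `κ⁺ = 2`,
`κ_c = 3∕2`, `ρ = ρ_c = 0`, `m₀ = 0`, `γ = 1`: the hypotheses of `termSum_torus_end_fibre` are jointly satisfiable. [folklore] -/
example : termSum (decFamilyΩ (tcellAt 8 (fun _ : Fin 2 => (UT.ofSite (fun _ : Fin 1 => 8) fun _ => 0)))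
      (ETor 1 fun _ : Fin 2 => (UT.ofSite (fun _ : Fin 1 => 8) fun _ => 0))
      (tdomOf 8 (fun _ : Fin 2 => (UT.ofSite (fun _ : Fin 1 => 8) fun _ => 0)) (fun _ : Fin 1 => (∅ : Finset (Fin 1 → ℤ))))
      (hTor 1 fun _ : Fin 2 => (UT.ofSite (fun _ : Fin 1 => 8) fun _ => 0)) (fun _ : Fin 1 => (0 : Matrix (Fin 2) (Fin 2) ℂ))
      (fun _ => (Finset.univ : Finset (Fin 1)))
      (fun b => locInv (Knear (fun _ : Fin 1 => (0 : Matrix (Fin 2) (Fin 2) ℂ)) (fun _ => Finset.univ) b)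
        (ETor 1 fun _ : Fin 2 => (UT.ofSite (fun _ : Fin 1 => 8) fun _ => 0)) b) (fun _ => (1 : ℂ)) 0) 1
    = (1 + Ktot (fun _ : Fin 1 => (0 : Matrix (Fin 2) (Fin 2) ℂ)))⁻¹ := by
  refine termSum_torus_end_fibre (ν := 1) (N := fun _ : Fin 1 => 8) one_pos (M₀ := 1) (Md := 8) le_rfl
    (fun _ => one_dvd _) (fun _ => by norm_num) (by norm_num) (fun _ => dvd_rfl)
    (fun _ : Fin 2 => (UT.ofSite (fun _ : Fin 1 => 8) fun _ => 0)) (m := 2) (fun x => ?_) (κ := 0) (κ₁ := 1) (κ₂ := 0)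
    (κp := 2) (ρ := 0) (ρc := 0) (m₀ := 0) (γ := 1) (κc := 3 / 2) le_rfl one_pos le_rfl
    (fun _ : Fin 1 => (0 : Matrix (Fin 2) (Fin 2) ℂ)) (fun _ => ∅) (fun ω k l hk => by simp at hk) (fun _ => Finset.univ)
    (fun b ω hω => absurd (Finset.mem_univ ω) hω) (by norm_num) (by norm_num) (fun k => by simp [pieceMaj])
    (fun l => by simp [pieceMaj]) (fun z => ?_) (by norm_num) (by norm_num) 0
  · calc ((Finset.univ.filter fun y : Fin 2 => (UT.ofSite (fun _ : Fin 1 => 8) fun _ => (0 : Fin 8)) = x).card : ℝ)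
        ≤ (Finset.univ : Finset (Fin 2)).card := by exact_mod_cast Finset.card_le_card (Finset.filter_subset _ _)
      _ = (2 : ℕ) := by simp
  · have hK : Ktot (fun _ : Fin 1 => (0 : Matrix (Fin 2) (Fin 2) ℂ)) = 0 := by simp [Ktot]
    have hform : star z ⬝ᵥ ((1 : Matrix (Fin 2) (Fin 2) ℂ) *ᵥ z) = ((nsq z : ℝ) : ℂ) := by
      rw [← AccretiveCombesThomas.conjForm_zero_rate 1 (fun _ => (0 : ℝ)) z,
        UnitLatticeWalkInversionDecay.conjForm_one]
    rw [hK, add_zero, hform, Complex.ofReal_re, one_mul]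

end

end Summit.QuantumFields.BalabanUV.Beta.UnitLatticeOmegaFibred
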